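import Literature.NumberTheory.Rogawski1990.ArchStableSumGProduct              -- ★ (12′) FILE P (LH7-p01 (g7)) p852033: `sum_partnerPerms_mul_eq_sum_mul_sum`, `mem_partnerPerms_iff_restrict`; brings ★ `stableSumG`, `partnerPerms`, `slotPerm`
import Literature.NumberTheory.Rogawski1990.ArchStableSumGClassSum             -- ★ (2) (LH10-p02 (g9)) p851944: `stableSumG_eq_archRG_mul_sum_div_of_mem_regG` (the plain reading of a stable sum on `RegG`)
import HarnessLib

/-!
# EP ASSEMBLY, THE CORE IDENTITY: from the four readings of a ball — the `β`-side tensor reading, the `α`-side definite closed form, the block transport at the indefinite places and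
# the one-place COMPACT clauses of the generators — to `6^{#D} · Σ_ρ Φ_β(ρ·c) = 2^{#D} · Σ_ρ Φ_α(ρ·c)`, i.e. `SS_β = 3^{-#D} · SS_α` (Rogawski 1990 §4.1, §8.2; Shelstad 1979 Lemma 4.2)

Topic `NumberTheory/Rogawski1990`; namespace `Literature.NumberTheory.Rogawski1990`.  THEOREMS ONLY (no `def`, no instance, no notation, no axiom, no named fact, no `sorry`); PURE FINITE
ALGEBRA over ★ FILE P, generic place type `W` and block predicate `p` («`w` is `α`-definite»).  Cell `pub/hodgecm-mathlib`, crux H413 (`stmt-HodgeConjecture-24833`), F0∕P3c road «N8-INNER» ROAD B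
«EP road» (owner LH2-plan (g1)), brick (12′) «EP ASSEMBLY», holder LH3-p04 (g7) (CENSUS-E3 v1 `F0/P3c/LH3/LH3-p04/g7/e3/CENSUS-E3.v1.LH3p04g7.md` §2 (3)(5)).  Count-neutral, gate-free: the analytic
readings enter E3a as the HYPOTHESES of `sum_partnerPerms_eq_of_readings` and are discharged there by ★ (F2) (tensor reading), ★ E2a∕E2b (definite closed form), (IT)-3 (block transport),
★ E1-generators ((7) ★ p852141, (8), (10)).

THE MATHEMATICS.  Fix a label `S` avoiding the block `p` (`hS : p w → w ∉ S`), a coordinate `c`, and the «plain» chart readings `Φ_β, Φ_α : (W → Fin 3 → ℝ) → ℂ` of the two sides (the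
families divided by the common, frame-free normaliser ★ `archRG S`).  Suppose
(β) TENSOR READING at every partner point: `Φ_β (ρ·c) = (Π_{w : p} m_w · g_w (c_w ∘ ρ_w)) · R_β (ρ|_{¬p})` (one-place generator readings `g_w`, class weights `m_w`, an `I`-block reading `R_β`);
(α) DEFINITE CLOSED FORM: `Σ_ρ Φ_α (ρ·c) = r · 6^{#p} · Σ_{ρ₂ ∈ partnerPerms S|_{¬p}} R_α ρ₂` (`r = Π_w r_w` the value of the class multiplier);
(IT) BLOCK TRANSPORT: `R_β ρ₂ = R_α ρ₂` — asked only where the class multiplier `r = Π_w r_w` is non-zero (that is where the local class germ is valid);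
(gen) COMPACT CLAUSES, weighted: `m_w · Σ_{σ ∈ S₃} g_w (c_w ∘ σ) = 2 · r_w` at each `w : p` (the generator gives `Σ_σ g_w = h_w(cl_w)`, the weight is `m_w = 2 F_w ∕ h_w`, `r_w = F_w(cl_w)`;
when `F_w(cl_w) = 0` both sides vanish).
Then `Σ_ρ Φ_β (ρ·c) = [Σ_{ρ₁ : p-block} Π_w m_w g_w (c_w ∘ ρ₁ w)] · Σ_{ρ₂} R_β ρ₂` (★ FILE P `sum_partnerPerms_mul_eq_sum_mul_sum`; `S|_p = ∅` so `ρ₁` ranges over ALL of `S₃^p`),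
`= Π_w (m_w Σ_σ g_w (c_w ∘ σ)) · Σ R_β = 2^{#p} r · Σ R_α` (`Finset.prod_univ_sum`), while `Σ_ρ Φ_α (ρ·c) = 6^{#p} r · Σ R_α`: **`6^{#p} · Σ_ρ Φ_β (ρ·c) = 2^{#p} · Σ_ρ Φ_α (ρ·c)`**
(`sum_partnerPerms_eq_of_readings`), i.e. `Σ_ρ Φ_β = 3^{-#p} · Σ_ρ Φ_α`; and for the STABLE SUMS of any two families `F_β, F_α` on `RegG S` (★ `stableSumG_eq_archRG_mul_sum_div_of_mem_regG`:
`SS F S c = archRG S c · Σ_ρ F S (ρc) ∕ archRG S (ρc)`) the same identity reads **`stableSumG F_β S c = 3^{-#p} · stableSumG F_α S c`** (`stableSumG_eq_inv_pow_mul_of_readings`) — H-S4′'s `κ = 3^{-#D}`.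
* §1 `subtype_eq_empty_of_forall_not`, `partnerPerms_subtype_eq_univ_of_forall_not`, `sum_partnerPerms_prod_eq_prod_sum` (the `p`-block partner sum of a product is the product of the `S₃`-sums).
* §2 **`sum_partnerPerms_eq_of_readings`**, `sum_partnerPerms_eq_inv_pow_mul_of_readings`.
* §3 **`stableSumG_eq_inv_pow_mul_of_readings`** (on `RegG S`, any families).
HONEST LABEL: HC_CM is proved only modulo the 7 printed citations (2 remaining: hLiu418 = `stmt-HodgeConjecture-24832`, h413 = `stmt-HodgeConjecture-24833`) until rung 0 closes; algebra only.

## References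
* [Rogawski1990] J. D. Rogawski, *Automorphic Representations of Unitary Groups in Three Variables*, Ann. of Math. Stud. 123 (1990), §4.1 (4.1.1) p. 39 (the `R_T`-normalised stable
  orbital integrals), §8.2 p. 122, §14.2 (14.2.1) pp. 232–233.
* [Shelstad1979] D. Shelstad, *Characters and inner forms of a quasi-split group over ℝ*, Compositio Math. 39 (1979), §4 pp. 22–26, Lemma 4.2 p. 23 (stable orbital integrals as sums over
  the Weyl-group images; the constant of transfer between inner forms).
-/

set_option autoImplicit false

noncomputable section

open Complex Finset Equiv
open scoped Classical
open Literature.NumberTheory.Automorphic.ArchCartan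

namespace Literature.NumberTheory.Rogawski1990

variable {W : Type*} [Fintype W] [DecidableEq W] (p : W → Prop) [DecidablePred p]

/-! ## §1 The `p`-block of a label avoiding `p`; partner sums of products over the block -/

section Block

omit [Fintype W] [DecidableEq W] in
/-- A label avoiding the block restricts to the empty label on the block. [cite: Shelstad1979, Lemma 4.2 p. 23] -/
theorem subtype_eq_empty_of_forall_not {S : Finset W} (hS : ∀ w, p w → w ∉ S) : S.subtype p = ∅ :=
  Finset.eq_empty_of_forall_notMem fun w hw => hS w.1 w.2 (Finset.mem_subtype.1 hw)

/-- On a label avoiding the block, the block's partner relabellings are ALL of `S₃^p`. [cite: Shelstad1979, Lemma 4.2 p. 23] -/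
theorem partnerPerms_subtype_eq_univ_of_forall_not {S : Finset W} (hS : ∀ w, p w → w ∉ S) : partnerPerms (S.subtype p) = Finset.univ := by
  rw [subtype_eq_empty_of_forall_not p hS]
  ext ρ
  simp only [Finset.mem_univ, iff_true, mem_partnerPerms_iff]
  intro w hw
  exact absurd hw (Finset.notMem_empty w)

/-- **The block partner sum of a PRODUCT of one-place terms is the product of the one-place `S₃`-sums**: for a label avoiding `p`,
`Σ_{ρ₁ ∈ partnerPerms S|_p} Π_{w : p} G_w (ρ₁ w) = Π_{w : p} Σ_{σ ∈ S₃} G_w σ` (`Finset.prod_univ_sum`). [cite: Shelstad1979, Lemma 4.2 p. 23] [cite: Rogawski1990, §4.1 (4.1.1) p. 39] -/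
theorem sum_partnerPerms_prod_eq_prod_sum {R : Type*} [CommSemiring R] {S : Finset W} (hS : ∀ w, p w → w ∉ S) (G : {w // p w} → Equiv.Perm (Fin 3) → R) :
    ∑ ρ₁ ∈ partnerPerms (S.subtype p), ∏ w : {w // p w}, G w (ρ₁ w) = ∏ w : {w // p w}, ∑ σ : Equiv.Perm (Fin 3), G w σ := by
  rw [partnerPerms_subtype_eq_univ_of_forall_not p hS]
  have h := Finset.prod_univ_sum (fun _ : {w // p w} => (Finset.univ : Finset (Equiv.Perm (Fin 3)))) fun w σ => G w σ
  rw [Fintype.piFinset_univ] at h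
  exact h.symm

end Block

/-! ## §2 The core identity of the EP assembly -/

section Core

/-- **THE CORE IDENTITY OF THE EP ASSEMBLY.**  For a label `S` avoiding the block `p`, a coordinate `c` and the plain readings `Φ_β, Φ_α` of the two sides: the `β`-side TENSOR READING at the
partner points (`hβ`), the `α`-side DEFINITE CLOSED FORM (`hα`, with the `6^{#p}` count of ★ E2a), the BLOCK TRANSPORT `R_β = R_α` on the indefinite block (`hIT`, guarded by `Π_w r_w ≠ 0`) and the WEIGHTED COMPACT
CLAUSES of the one-place generators (`hgen : m_w · Σ_σ g_w (c_w ∘ σ) = 2 r_w`) give **`6^{#p} · Σ_ρ Φ_β (ρ·c) = 2^{#p} · Σ_ρ Φ_α (ρ·c)`**.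
[cite: Rogawski1990, §4.1 (4.1.1) p. 39; §14.2 (14.2.1) p. 232] [cite: Shelstad1979, Lemma 4.2 p. 23] -/
theorem sum_partnerPerms_eq_of_readings {S : Finset W} (hS : ∀ w, p w → w ∉ S) (c : W → Fin 3 → ℝ) (Φβ Φα : (W → Fin 3 → ℝ) → ℂ)
    (m : {w // p w} → ℂ) (g : {w // p w} → (Fin 3 → ℝ) → ℂ) (r : {w // p w} → ℂ) (Rβ Rα : ({w // ¬ p w} → Equiv.Perm (Fin 3)) → ℂ)
    (hβ : ∀ ρ ∈ partnerPerms S, Φβ (slotPerm ρ c) = (∏ w : {w // p w}, m w * g w (c w.1 ∘ ⇑(ρ w.1))) * Rβ fun w : {w // ¬ p w} => ρ w.1)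
    (hα : ∑ ρ ∈ partnerPerms S, Φα (slotPerm ρ c) =
      (∏ w : {w // p w}, r w) * (6 : ℂ) ^ Fintype.card {w // p w} * ∑ ρ₂ ∈ partnerPerms (S.subtype fun w => ¬ p w), Rα ρ₂)
    (hIT : (∏ w : {w // p w}, r w) ≠ 0 → ∀ ρ₂ ∈ partnerPerms (S.subtype fun w => ¬ p w), Rβ ρ₂ = Rα ρ₂)
    (hgen : ∀ w : {w // p w}, m w * ∑ σ : Equiv.Perm (Fin 3), g w (c w.1 ∘ ⇑σ) = 2 * r w) :
    (6 : ℂ) ^ Fintype.card {w // p w} * ∑ ρ ∈ partnerPerms S, Φβ (slotPerm ρ c) = (2 : ℂ) ^ Fintype.card {w // p w} * ∑ ρ ∈ partnerPerms S, Φα (slotPerm ρ c) := by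
  -- the `β`-side partner sum: tensor ⇒ (block partner sum of the product) × (indefinite-block sum)
  have hβsum : ∑ ρ ∈ partnerPerms S, Φβ (slotPerm ρ c) =
      (∑ ρ₁ ∈ partnerPerms (S.subtype p), ∏ w : {w // p w}, m w * g w (c w.1 ∘ ⇑(ρ₁ w))) *
        ∑ ρ₂ ∈ partnerPerms (S.subtype fun w => ¬ p w), Rβ ρ₂ := by
    rw [Finset.sum_congr rfl hβ, sum_partnerPerms_eq_sum_sum_restrict p S, Finset.sum_mul_sum]
    refine Finset.sum_congr rfl fun ρ₁ _ => Finset.sum_congr rfl fun ρ₂ _ => ?_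
    rw [restrict_piEquivPiSubtypeProd_symm_snd]
    congr 1
    refine Finset.prod_congr rfl fun w _ => ?_
    rw [Equiv.piEquivPiSubtypeProd_symm_apply, dif_pos w.2]
  -- the block partner sum of the product = product of the weighted compact clauses
  have hblock : ∑ ρ₁ ∈ partnerPerms (S.subtype p), ∏ w : {w // p w}, m w * g w (c w.1 ∘ ⇑(ρ₁ w)) = ∏ w : {w // p w}, (2 * r w) := by
    rw [sum_partnerPerms_prod_eq_prod_sum p hS (fun w σ => m w * g w (c w.1 ∘ ⇑σ))]
    refine Finset.prod_congr rfl fun w _ => ?_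
    rw [← Finset.mul_sum]
    exact hgen w
  rw [hβsum, hblock, hα, Finset.prod_mul_distrib, Finset.prod_const, Finset.card_univ]
  -- the block transport is needed only where the class multiplier is non-zero
  by_cases hr : (∏ w : {w // p w}, r w) = 0
  · rw [hr]; ring
  · rw [Finset.sum_congr rfl (hIT hr)]; ring

/-- **The same as `Σ_ρ Φ_β (ρ·c) = 3^{-#p} · Σ_ρ Φ_α (ρ·c)`** — the constant `κ = 3^{-#D}` of H-S4′. [cite: Rogawski1990, §14.2 (14.2.1) p. 232] [cite: Shelstad1979, Lemma 4.2 p. 23] -/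
theorem sum_partnerPerms_eq_inv_pow_mul_of_readings {S : Finset W} (hS : ∀ w, p w → w ∉ S) (c : W → Fin 3 → ℝ) (Φβ Φα : (W → Fin 3 → ℝ) → ℂ)
    (m : {w // p w} → ℂ) (g : {w // p w} → (Fin 3 → ℝ) → ℂ) (r : {w // p w} → ℂ) (Rβ Rα : ({w // ¬ p w} → Equiv.Perm (Fin 3)) → ℂ)
    (hβ : ∀ ρ ∈ partnerPerms S, Φβ (slotPerm ρ c) = (∏ w : {w // p w}, m w * g w (c w.1 ∘ ⇑(ρ w.1))) * Rβ fun w : {w // ¬ p w} => ρ w.1)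
    (hα : ∑ ρ ∈ partnerPerms S, Φα (slotPerm ρ c) =
      (∏ w : {w // p w}, r w) * (6 : ℂ) ^ Fintype.card {w // p w} * ∑ ρ₂ ∈ partnerPerms (S.subtype fun w => ¬ p w), Rα ρ₂)
    (hIT : (∏ w : {w // p w}, r w) ≠ 0 → ∀ ρ₂ ∈ partnerPerms (S.subtype fun w => ¬ p w), Rβ ρ₂ = Rα ρ₂)
    (hgen : ∀ w : {w // p w}, m w * ∑ σ : Equiv.Perm (Fin 3), g w (c w.1 ∘ ⇑σ) = 2 * r w) :
    ∑ ρ ∈ partnerPerms S, Φβ (slotPerm ρ c) = ((3 : ℂ)⁻¹) ^ Fintype.card {w // p w} * ∑ ρ ∈ partnerPerms S, Φα (slotPerm ρ c) := by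
  have h := sum_partnerPerms_eq_of_readings p hS c Φβ Φα m g r Rβ Rα hβ hα hIT hgen
  have h6 : (6 : ℂ) ^ Fintype.card {w // p w} ≠ 0 := pow_ne_zero _ (by norm_num)
  apply mul_left_cancel₀ h6
  rw [h, ← mul_assoc, ← mul_pow]
  norm_num

end Core

/-! ## §3 The same for stable sums on the regular set -/

section Stable

/-- **STABLE-SUM FORM OF THE CORE IDENTITY.**  For ANY two Cartan-indexed families `F_β, F_α` (on the EP road: `orbFamGExt L β₀ νβ f_J` and `orbFamGExt L α ν′ a′_J`), a label `S` avoiding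
the definite block `p` and `c ∈ RegG S`: if the PLAIN READINGS `Φ_• c′ := F_• S c′ ∕ archRG S c′` (★ `stableSumG_eq_archRG_mul_sum_div_of_mem_regG`; ★ `archRG` is frame-free) satisfy the
four reading hypotheses of `sum_partnerPerms_eq_of_readings`, then **`stableSumG F_β S c = 3^{-#p} · stableSumG F_α S c`**, which is H-S4′'s identity at `(S, c)` with `κ = 3^{-#D}` once
★ `stableSumG_smul` moves `κ` inside the family. [cite: Rogawski1990, §4.1 (4.1.1) p. 39; §14.2 (14.2.1) p. 232] [cite: Shelstad1979, Lemma 4.2 p. 23] -/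
theorem stableSumG_eq_inv_pow_mul_of_readings {S : Finset W} (hS : ∀ w, p w → w ∉ S) {c : W → Fin 3 → ℝ} (hc : c ∈ RegG S)
    (Fβ Fα : Finset W → (W → Fin 3 → ℝ) → ℂ)
    (m : {w // p w} → ℂ) (g : {w // p w} → (Fin 3 → ℝ) → ℂ) (r : {w // p w} → ℂ) (Rβ Rα : ({w // ¬ p w} → Equiv.Perm (Fin 3)) → ℂ)
    (hβ : ∀ ρ ∈ partnerPerms S, Fβ S (slotPerm ρ c) / archRG S (slotPerm ρ c) = (∏ w : {w // p w}, m w * g w (c w.1 ∘ ⇑(ρ w.1))) * Rβ fun w : {w // ¬ p w} => ρ w.1)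
    (hα : ∑ ρ ∈ partnerPerms S, Fα S (slotPerm ρ c) / archRG S (slotPerm ρ c) =
      (∏ w : {w // p w}, r w) * (6 : ℂ) ^ Fintype.card {w // p w} * ∑ ρ₂ ∈ partnerPerms (S.subtype fun w => ¬ p w), Rα ρ₂)
    (hIT : (∏ w : {w // p w}, r w) ≠ 0 → ∀ ρ₂ ∈ partnerPerms (S.subtype fun w => ¬ p w), Rβ ρ₂ = Rα ρ₂)
    (hgen : ∀ w : {w // p w}, m w * ∑ σ : Equiv.Perm (Fin 3), g w (c w.1 ∘ ⇑σ) = 2 * r w) :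
    stableSumG Fβ S c = ((3 : ℂ)⁻¹) ^ Fintype.card {w // p w} * stableSumG Fα S c := by
  rw [stableSumG_eq_archRG_mul_sum_div_of_mem_regG Fβ hc, stableSumG_eq_archRG_mul_sum_div_of_mem_regG Fα hc,
    sum_partnerPerms_eq_inv_pow_mul_of_readings p hS c (fun c' => Fβ S c' / archRG S c') (fun c' => Fα S c' / archRG S c') m g r Rβ Rα hβ hα hIT hgen]
  ring

/-- **H-S4′'s right-hand side**: `stableSumG (fun S′ c′ => κ · F S′ c′) S c = κ · stableSumG F S c` (★ `stableSumG_smul`). [cite: Shelstad1979, Lemma 4.2 p. 23] -/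
theorem stableSumG_const_mul_family (κ : ℂ) (F : Finset W → (W → Fin 3 → ℝ) → ℂ) (S : Finset W) (c : W → Fin 3 → ℝ) :
    stableSumG (fun S' c' => κ * F S' c') S c = κ * stableSumG F S c :=
  stableSumG_smul κ F S c

end Stable


end Literature.NumberTheory.Rogawski1990

end
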